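import Summits.BirchSwinnertonDyer.BirchSwinnertonDyer.Theorems.PrintCf2RamifiedOffTYZQFormOddForest
import HarnessLib

/-!
# Route `PrintCf2`, crux stmt-BirchSwinnertonDyer-20509 `RamifiedOffTYZOfFacts` — the Q-form identity (★) for `n ≡ 7 (mod 8)`: THE PAIR IDENTITY (★a)₇
# (cell `bsd-print-cf2`, LEAD of 20509 g8, line `offtyz-v7`, cycle 9; kernel helpers `--supports stmt-BirchSwinnertonDyer-20509`)

Second forest layer of the proof of (★)₇ (g5's `Q_n = q(κ_n)` in Ω-form at `∏ pᵢ ≡ 7 (mod 8)`; successor task of the LEAD g7,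
`Cruxes/RamifiedOffTYZOfFacts/Lines/offtyz_v7_MoverAssembly.md` §6 (a)). With `Ñ = bigN a D y z 0 = [[D_y, Pᵀ],[P, D_z]]` (abstract arc weights
under the reciprocity law `a s t + a t s = y_s y_t`; NO parity hypothesis on `D` is needed for this clause):

  **(★a)₇** `adj(Ñ)_{(inr s)(inr s)} + adj(Ñ)_{(inr t)(inr t)} = Σ_{B ∋ s,t, Σ_B y = 0, Σ_B z = 1} (κ_s(B) + κ_t(B)) · det Ñ_{D∖B}`  (`s ≠ t`).

Proof (double counting over pairs of disjoint blocks `X ∋ s`, `Y ∋ t`): the root-copy cofactor `adj(Ñ)_{(inr s)(inr s)}` is the rooted pointed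
sum `Σ_{X ∋ s} (Σ_X y) κ_s(X) det Ñ_{D∖X}` (tree); the blocks `X ∋ s, t` cancel between the two cofactors (odd blocks are flat, even ones weigh
`0`); in the rest, point the block `Y ∋ t` of the complement (`fwt a y z 0 Y = (Σ_Y y)(Σ_Y z) κ_t(Y)`). On the right, `κ_s(B) + κ_t(B) =
q_{e_s+e_t}(B)` of the EVEN block `B` is expanded by the pinned all-minors expansion at `s` (`pinned_expansion_eq`) into `Σ_{B = X ⊔ Y, s ∈ X, t ∈ Y}
κ_s(X) setExp(q_y)(Y)` with `setExp(q_y)(Y) = (Σ_Y y) q_y(Y)` (reciprocity lemma). Both sides become `Σ_{(X,Y)} (Σ_X y)(Σ_Y y)(Σ_X z + Σ_Y z)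
κ_s(X) κ_t(Y) det Ñ_{D∖X∖Y}`. For Monsky's data the left side is `(κA+κB)_s + (κA+κB)_t` of Monsky's kernel sum (bridge file) and the right
side is `Ω_st + Ω_ts`. Pure linear algebra over `𝔽₂`; no number theory, no `sorry`. BSD is not proved by any of this; no class is closed.

References: [cite: Chaiken1982, §2 (all minors matrix tree theorem)]; [cite: Smith2016CongruentDensity, §2.2 case 5(b)];
[cite: HeathBrown1994SelmerCongruentII, Appendix (Monsky), typescript p. 39 L27 – p. 40 L31]; [cite: Stanley1999EC2, Cor. 5.1.6].
-/

namespace Summit.BirchSwinnertonDyer.PrintCf2.QFormForest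

open Matrix Finset Literature.LinearAlgebra.Matrix Literature.Combinatorics.Enumerative
open Literature.NumberTheory.EllipticCurves.Smith2016

variable {V : Type*} [Fintype V] [LinearOrder V]

/-! ## §1. Bookkeeping -/

omit [Fintype V] [LinearOrder V] in
/-- The subsets of `S` avoiding `t` are the subsets of `S ∖ t`. [folklore] -/
theorem powerset_filter_not_mem_eq [DecidableEq V] (S : Finset V) (t : V) :
    S.powerset.filter (fun B => ¬ t ∈ B) = (S.erase t).powerset := by
  ext B
  simp only [mem_filter, mem_powerset, subset_erase]

omit [Fintype V] [LinearOrder V] in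
/-- Complementation inside `W` re-indexes a sum over the subsets of `W`. [folklore] -/
theorem sum_powerset_eq_sum_powerset_sdiff [DecidableEq V] {R : Type*} [AddCommMonoid R] (W : Finset V) (g : Finset V → R) :
    ∑ A ∈ W.powerset, g A = ∑ A ∈ W.powerset, g (W \ A) := by
  refine sum_bij' (fun A _ => W \ A) (fun A _ => W \ A) ?_ ?_ ?_ ?_ ?_
  · intro A _; exact mem_powerset.mpr sdiff_subset
  · intro A _; exact mem_powerset.mpr sdiff_subset
  · intro A hA; rw [mem_powerset] at hA; exact Finset.sdiff_sdiff_eq_self hA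
  · intro A hA; rw [mem_powerset] at hA; exact Finset.sdiff_sdiff_eq_self hA
  · intro A hA; rw [mem_powerset] at hA; rw [Finset.sdiff_sdiff_eq_self hA]

omit [Fintype V] [LinearOrder V] in
/-- `(D ∖ s) ∖ X₀ = {t} ∪ ((D ∖ s ∖ t) ∖ X₀)` for `X₀ ⊆ D ∖ s ∖ t`, `t ∈ D`, `t ≠ s`. [folklore] -/
theorem erase_sdiff_eq_insert [DecidableEq V] {D X₀ : Finset V} {s t : V} (ht : t ∈ D) (hst : s ≠ t)
    (hX₀ : X₀ ⊆ (D.erase s).erase t) : D.erase s \ X₀ = insert t (((D.erase s).erase t) \ X₀) := by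
  have htX₀ : t ∉ X₀ := fun h => notMem_erase t _ (hX₀ h)
  ext i
  simp only [mem_sdiff, mem_erase, mem_insert]
  constructor
  · rintro ⟨⟨his, hiD⟩, hiX⟩
    by_cases hit : i = t
    · exact Or.inl hit
    · exact Or.inr ⟨⟨hit, his, hiD⟩, hiX⟩
  · rintro (rfl | ⟨⟨_, his, hiD⟩, hiX⟩)
    · exact ⟨⟨hst.symm, ht⟩, htX₀⟩
    · exact ⟨⟨his, hiD⟩, hiX⟩

omit [Fintype V] in
/-- `D ∖ ({s, t} ∪ W₀) = (D ∖ s ∖ t) ∖ W₀`. [folklore] -/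
theorem sdiff_insert_insert_eq (D W₀ : Finset V) (s t : V) :
    D \ insert s (insert t W₀) = ((D.erase s).erase t) \ W₀ := by
  rw [← erase_sdiff_eq_sdiff_insert, ← erase_sdiff_eq_sdiff_insert]

omit [Fintype V] [LinearOrder V] in
/-- `{s} ∪ X₀ ∪ ({t} ∪ (W₀ ∖ X₀)) = {s, t} ∪ W₀` for `X₀ ⊆ W₀`. [folklore] -/
theorem insert_union_insert_sdiff [DecidableEq V] {W₀ X₀ : Finset V} (hX₀ : X₀ ⊆ W₀) (s t : V) :
    insert s X₀ ∪ insert t (W₀ \ X₀) = insert s (insert t W₀) := by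
  rw [insert_union, union_insert, union_sdiff_of_subset hX₀]

omit [Fintype V] [LinearOrder V] in
/-- `{s} ∪ X₀` and `{t} ∪ (W₀ ∖ X₀)` are disjoint when `s, t ∉ W₀`, `s ≠ t`. [folklore] -/
theorem disjoint_insert_insert_sdiff [DecidableEq V] {W₀ X₀ : Finset V} {s t : V} (hX₀ : X₀ ⊆ W₀) (hs : s ∉ W₀) (ht : t ∉ W₀)
    (hst : s ≠ t) : Disjoint (insert s X₀) (insert t (W₀ \ X₀)) := by
  rw [disjoint_insert_left, disjoint_insert_right, mem_insert]
  refine ⟨fun h => h.elim hst (fun h => hs (sdiff_subset h)), fun h => ht (hX₀ h), disjoint_sdiff⟩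

/-! ## §2. Splitting the root-copy cofactor along `t` -/

/-- **The root-copy cofactor split along a second vertex** (no reciprocity needed): for `s ≠ t ∈ D` and `Ñ = bigN a D y z 0`,
`adj(Ñ)_{(inr s)(inr s)} = Σ_{B₁ ⊆ D₀} (Σ_B y) κ_s(B) Θ(D₀∖B₁) + Σ_{W₀ ⊆ D₀} Θ(D₀∖W₀) · Σ_{X₀ ⊆ W₀} (Σ_X y) κ_s(X) · fwt a y z 0 ({t} ∪ (W₀∖X₀))`
(`D₀ = D∖s∖t`, `B = {s,t} ∪ B₁`, `X = {s} ∪ X₀`, `Θ = setExp (fwt a y z 0)`): the rooted pointed forest sum (`adjugate_bigN_inr_inr`) split by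
`t ∈ B` / `t ∉ B`, and in the second case the block of `t` in the complement pointed (`setExp_peel`) and the pair regrouped by its union.
[cite: Chaiken1982, §2 (all minors matrix tree theorem)] [cite: Stanley1999EC2, Cor. 5.1.6] -/
theorem adjugate_bigN_zero_root_inr_inr_split (a : V → V → ZMod 2) (y z : V → ZMod 2) {D : Finset V} {s t : V}
    (hs : s ∈ D) (ht : t ∈ D) (hst : s ≠ t) :
    (bigN a D y z 0).adjugate (Sum.inr s) (Sum.inr s) =
      ∑ B₁ ∈ ((D.erase s).erase t).powerset,
          (∑ i ∈ insert s (insert t B₁), y i) * treeDet a (insert s (insert t B₁)) s *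
            setExp (fwt a y z 0) (((D.erase s).erase t) \ B₁) +
      ∑ W₀ ∈ ((D.erase s).erase t).powerset, setExp (fwt a y z 0) (((D.erase s).erase t) \ W₀) *
          ∑ X₀ ∈ W₀.powerset, (∑ i ∈ insert s X₀, y i) * treeDet a (insert s X₀) s * fwt a y z 0 (insert t (W₀ \ X₀)) := by
  set D₀ := (D.erase s).erase t with hD₀
  have ht' : t ∈ D.erase s := mem_erase.mpr ⟨hst.symm, ht⟩
  have htD₀ : t ∉ D₀ := notMem_erase t _
  rw [adjugate_bigN_inr_inr a hs y z 0, ← sum_filter_add_sum_filter_not (D.erase s).powerset (fun B₀ => t ∈ B₀)]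
  congr 1
  · -- blocks containing `t`
    rw [sum_powerset_filter_mem_eq _ ht']
    refine sum_congr rfl fun B₁ _ => ?_
    rw [insert_comm, erase_sdiff_eq_sdiff_insert (D.erase s) B₁ t]
  · -- blocks avoiding `t`: point the block of `t` in the complement and regroup
    rw [powerset_filter_not_mem_eq]
    have hpeel : ∀ X₀ ∈ D₀.powerset,
        (∑ i ∈ insert s X₀, y i) * treeDet a (insert s X₀) s * setExp (fwt a y z 0) (D.erase s \ X₀) =
          ∑ E ∈ (D₀ \ X₀).powerset, (∑ i ∈ insert s X₀, y i) * treeDet a (insert s X₀) s *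
            (fwt a y z 0 (insert t ((X₀ ∪ E) \ X₀)) * setExp (fwt a y z 0) (D₀ \ (X₀ ∪ E))) := by
      intro X₀ hX₀
      rw [mem_powerset] at hX₀
      rw [erase_sdiff_eq_insert ht hst hX₀, setExp_peel _ (mem_insert_self t _),
        erase_insert (fun h => htD₀ (sdiff_subset h)), mul_sum]
      refine sum_congr rfl fun E hE => ?_
      rw [mem_powerset] at hE
      rw [union_sdiff_cancel_left (disjoint_of_subset_right hE disjoint_sdiff), sdiff_sdiff_left, sup_eq_union]
    rw [sum_congr rfl hpeel, ← sum_powerset_sum_powerset_sub D₀ (fun X₀ W₀ =>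
      (∑ i ∈ insert s X₀, y i) * treeDet a (insert s X₀) s * (fwt a y z 0 (insert t (W₀ \ X₀)) * setExp (fwt a y z 0) (D₀ \ W₀)))]
    refine sum_congr rfl fun W₀ _ => ?_
    rw [mul_sum]
    exact sum_congr rfl fun X₀ _ => by ring

/-! ## §3. The right side: pinned expansion of the even block -/

/-- **`κ_s(B) + κ_t(B)` of an even block as a pinned sum**: under the reciprocity law on `B = {s,t} ∪ W₀` (`s, t ∉ W₀`, `s ≠ t`) with
`Σ_B y = 0`: `κ_s(B) + κ_t(B) = Σ_{X₀ ⊆ W₀} κ_s({s} ∪ X₀) · setExp(q_y)({t} ∪ (W₀∖X₀))` — the pinned all-minors expansion at `s` with root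
weights `e_s + e_t` (`pinned_expansion_eq`; `q_{e_s+e_t} = κ_s + κ_t`, total weight `0`), in which only the blocks `X ∌ t` survive.
[cite: Chaiken1982, §2] [cite: Smith2016CongruentDensity, §2.2 case 5(b)] -/
theorem treeDet_add_treeDet_eq_sum_pinned (a : V → V → ZMod 2) (y : V → ZMod 2) {W₀ : Finset V} {s t : V}
    (hsW₀ : s ∉ W₀) (htW₀ : t ∉ W₀) (hst : s ≠ t)
    (hrec : ∀ i ∈ insert s (insert t W₀), ∀ j ∈ insert s (insert t W₀), i ≠ j → a i j + a j i = y i * y j)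
    (hyB : ∑ i ∈ insert s (insert t W₀), y i = 0) :
    treeDet a (insert s (insert t W₀)) s + treeDet a (insert s (insert t W₀)) t =
      ∑ X₀ ∈ W₀.powerset, treeDet a (insert s X₀) s * setExp (qwt a y) (insert t (W₀ \ X₀)) := by
  set B := insert s (insert t W₀) with hB
  set x : V → ZMod 2 := fun i => (Pi.single s (1 : ZMod 2) : V → ZMod 2) i + (Pi.single t (1 : ZMod 2) : V → ZMod 2) i
    with hx
  have hsB : s ∈ B := mem_insert_self s _
  have htB : t ∈ B := mem_insert_of_mem (mem_insert_self t W₀)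
  have hstW : s ∉ insert t W₀ := fun h => (mem_insert.mp h).elim hst hsW₀
  have h := pinned_expansion_eq a y x hrec hyB hsB
  -- the right side of the pinned expansion: `q_x(B) = κ_s + κ_t`, `Σ_B x = 0`
  have hxB : ∑ i ∈ B, x i = 0 := by
    rw [hx, sum_add_distrib, sum_pi_single', sum_pi_single', if_pos hsB, if_pos htB, CharTwo.add_self_eq_zero]
  have hqx : qwt a x B = treeDet a B s + treeDet a B t := by
    rw [hx, qwt_add, qwt_single, qwt_single, if_pos hsB, if_pos htB]
  rw [hxB, zero_mul, add_zero, hqx, hB, erase_insert hstW] at h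
  rw [← h, ← sum_filter_add_sum_filter_not (insert t W₀).powerset (fun E => t ∈ E)]
  -- blocks containing `t` carry `Σ x = 0`
  have hzero : ∑ E ∈ (insert t W₀).powerset.filter (fun E => t ∈ E),
      (∑ i ∈ insert s E, x i) * treeDet a (insert s E) s * setExp (qwt a y) (insert t W₀ \ E) = 0 := by
    refine sum_eq_zero fun E hE => ?_
    rw [mem_filter] at hE
    have hxE : ∑ i ∈ insert s E, x i = 0 := by
      rw [hx, sum_add_distrib, sum_pi_single', sum_pi_single', if_pos (mem_insert_self s E),
        if_pos (mem_insert_of_mem hE.2), CharTwo.add_self_eq_zero]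
    rw [hxE, zero_mul, zero_mul]
  rw [hzero, zero_add, powerset_filter_not_mem_eq, erase_insert htW₀]
  refine sum_congr rfl fun X₀ hX₀ => ?_
  rw [mem_powerset] at hX₀
  have htX₀ : t ∉ X₀ := fun h' => htW₀ (hX₀ h')
  have hxX : ∑ i ∈ insert s X₀, x i = 1 := by
    rw [hx, sum_add_distrib, sum_pi_single', sum_pi_single', if_pos (mem_insert_self s X₀), if_neg, add_zero]
    exact fun h' => (mem_insert.mp h').elim (fun h'' => hst h''.symm) htX₀
  rw [hxX, one_mul, insert_sdiff_of_notMem W₀ htX₀]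

/-- **The right side of (★a)₇ regrouped**: `Σ_{B ∋ s,t adm} (κ_s(B) + κ_t(B)) det Ñ_{D∖B} = Σ_{W₀ ⊆ D₀} Θ(D₀∖W₀) · Σ_{X₀ ⊆ W₀} [B adm] κ_s(X)
setExp(q_y)(Y)` with `B = {s,t} ∪ W₀`, `X = {s} ∪ X₀`, `Y = {t} ∪ (W₀∖X₀)`. [cite: Chaiken1982, §2] [cite: Smith2016CongruentDensity, §2.2 case 5(b)] -/
theorem sum_admissible_pair_eq_sum_pinned (a : V → V → ZMod 2) (y z : V → ZMod 2) {D : Finset V}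
    (hrec : ∀ i ∈ D, ∀ j ∈ D, i ≠ j → a i j + a j i = y i * y j) {s t : V} (hs : s ∈ D) (ht : t ∈ D) (hst : s ≠ t) :
    ∑ B ∈ D.powerset.filter (fun B => s ∈ B ∧ t ∈ B ∧ (∑ i ∈ B, y i = 0 ∧ ∑ i ∈ B, z i = 1)),
        (treeDet a B s + treeDet a B t) * (bigN a (D \ B) y z 0).det =
      ∑ W₀ ∈ ((D.erase s).erase t).powerset, setExp (fwt a y z 0) (((D.erase s).erase t) \ W₀) *
        ∑ X₀ ∈ W₀.powerset,
          (if (∑ i ∈ insert s (insert t W₀), y i = 0 ∧ ∑ i ∈ insert s (insert t W₀), z i = 1) then 1 else 0) *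
            (treeDet a (insert s X₀) s * setExp (qwt a y) (insert t (W₀ \ X₀))) := by
  set D₀ := (D.erase s).erase t with hD₀
  have ht' : t ∈ D.erase s := mem_erase.mpr ⟨hst.symm, ht⟩
  have hsD₀ : s ∉ D₀ := fun h => notMem_erase s D (mem_of_mem_erase h)
  have htD₀ : t ∉ D₀ := notMem_erase t _
  have hD₀D : D₀ ⊆ D := (erase_subset t _).trans (erase_subset s D)
  rw [sum_powerset_filter_mem_and_eq _ hs (fun B => t ∈ B ∧ (∑ i ∈ B, y i = 0 ∧ ∑ i ∈ B, z i = 1))]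
  have hcongr : (D.erase s).powerset.filter (fun E => t ∈ insert s E ∧ (∑ i ∈ insert s E, y i = 0 ∧ ∑ i ∈ insert s E, z i = 1)) =
      (D.erase s).powerset.filter (fun E => t ∈ E ∧ (∑ i ∈ insert s E, y i = 0 ∧ ∑ i ∈ insert s E, z i = 1)) := by
    refine filter_congr fun E _ => ?_
    rw [mem_insert]
    exact ⟨fun ⟨h1, h2⟩ => ⟨h1.resolve_left (fun h => hst h.symm), h2⟩, fun ⟨h1, h2⟩ => ⟨Or.inr h1, h2⟩⟩
  rw [hcongr, sum_powerset_filter_mem_and_eq _ ht' (fun E => ∑ i ∈ insert s E, y i = 0 ∧ ∑ i ∈ insert s E, z i = 1), sum_filter]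
  refine sum_congr rfl fun W₀ hW₀ => ?_
  rw [mem_powerset] at hW₀
  have hsW₀ : s ∉ W₀ := fun h => hsD₀ (hW₀ h)
  have htW₀ : t ∉ W₀ := fun h => htD₀ (hW₀ h)
  have hBD : insert s (insert t W₀) ⊆ D := insert_subset hs (insert_subset ht (hW₀.trans hD₀D))
  by_cases hadm : ∑ i ∈ insert s (insert t W₀), y i = 0 ∧ ∑ i ∈ insert s (insert t W₀), z i = 1
  · rw [if_pos hadm, sdiff_insert_insert_eq, det_bigN_eq_setExp,
      treeDet_add_treeDet_eq_sum_pinned a y hsW₀ htW₀ hst (hrec_mono hBD hrec) hadm.1, mul_comm, mul_sum, mul_sum]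
    refine sum_congr rfl fun X₀ _ => ?_
    rw [if_pos hadm, one_mul]
  · rw [if_neg hadm]
    refine (Eq.trans (congrArg _ (sum_eq_zero fun X₀ _ => ?_)) (mul_zero _)).symm
    rw [if_neg hadm, zero_mul]

/-! ## §4. (★a)₇ in forest form -/

/-- In `𝔽₂`, `[u = 1] · c = u · c`. [folklore] -/
theorem ite_eq_one_mul (u c : ZMod 2) : (if u = 1 then c else 0) = u * c := by
  have h : ∀ u : ZMod 2, u = 0 ∨ u = 1 := by decide
  rcases h u with rfl | rfl
  · rw [if_neg zero_ne_one, zero_mul]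
  · rw [if_pos rfl, one_mul]

/-- **The termwise identity behind (★a)₇**: for disjoint blocks `X ∋ s`, `Y ∋ t` under the reciprocity law,
`(Σ_X y) κ_s(X) · fwt a y z 0 Y + (Σ_Y y) κ_t(Y) · fwt a y z 0 X = [Σ_X y + Σ_Y y = 0 ∧ Σ_X z + Σ_Y z = 1] · κ_s(X) · (Σ_Y y) q_y(Y)`
— both sides equal `(Σ_X y)(Σ_Y y)(Σ_X z + Σ_Y z) κ_s(X) κ_t(Y)` (odd blocks are flat). [cite: Smith2016CongruentDensity, §2.2 (chunk p0008 L42–L50)] [cite: Chaiken1982, §2] -/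
theorem pair_term_identity (a : V → V → ZMod 2) (y z : V → ZMod 2) {X Y : Finset V} {s t : V} (hs : s ∈ X) (ht : t ∈ Y)
    (hrecX : ∀ i ∈ X, ∀ j ∈ X, i ≠ j → a i j + a j i = y i * y j)
    (hrecY : ∀ i ∈ Y, ∀ j ∈ Y, i ≠ j → a i j + a j i = y i * y j) :
    (∑ i ∈ X, y i) * treeDet a X s * fwt a y z 0 Y + (∑ i ∈ Y, y i) * treeDet a Y t * fwt a y z 0 X =
      (if (∑ i ∈ X, y i + ∑ i ∈ Y, y i = 0 ∧ ∑ i ∈ X, z i + ∑ i ∈ Y, z i = 1) then 1 else 0) *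
        (treeDet a X s * ((∑ i ∈ Y, y i) * qwt a y Y)) := by
  have h01 : ∀ u : ZMod 2, u ≠ 1 → u = 0 := by decide
  by_cases hyY : ∑ i ∈ Y, y i = 1
  swap
  · have hyY0 := h01 _ hyY
    rw [fwt_zero_root_of_even a y z hyY0, hyY0]
    ring
  rw [fwt_zero_root_of_odd a y z hrecY hyY ht, qwt_eq_sum_mul_treeDet_of_odd a y y hrecY hyY ht, hyY, one_mul, one_mul]
  by_cases hyX : ∑ i ∈ X, y i = 1
  swap
  · have hyX0 := h01 _ hyX
    rw [fwt_zero_root_of_even a y z hyX0, hyX0, zero_add, if_neg (fun h => one_ne_zero h.1)]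
    ring
  rw [fwt_zero_root_of_odd a y z hrecX hyX hs, hyX, one_mul, CharTwo.add_self_eq_zero]
  have hite : (if ((0 : ZMod 2) = 0 ∧ ∑ i ∈ X, z i + ∑ i ∈ Y, z i = 1) then (1 : ZMod 2) else 0) =
      if ∑ i ∈ X, z i + ∑ i ∈ Y, z i = 1 then 1 else 0 := by
    by_cases h : ∑ i ∈ X, z i + ∑ i ∈ Y, z i = 1
    · rw [if_pos ⟨rfl, h⟩, if_pos h]
    · rw [if_neg (fun h' => h h'.2), if_neg h]
  rw [hite, ite_eq_one_mul]
  ring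

/-- **(★a)₇, forest form** (valid for EVERY vertex set — no parity hypothesis on `D`): under the reciprocity law on `D` and `s ≠ t ∈ D`,
with `Ñ = bigN a D y z 0`:
`adj(Ñ)_{(inr s)(inr s)} + adj(Ñ)_{(inr t)(inr t)} = Σ_{B ∋ s,t, Σ_B y = 0, Σ_B z = 1} (κ_s(B) + κ_t(B)) · det Ñ_{D∖B}`. For Monsky's data
(`n = p₁⋯p_k ≡ 7 (mod 8)`, `aᵀ s t = A_{ts}`) the left side is `(κA+κB)_s + (κA+κB)_t` of Monsky's kernel sum (bridge file) and the right side
is `Ω_st + Ω_ts` — the off-diagonal clause of g5's `QFormIdentityOmega` at `∏ pᵢ ≡ 7 (mod 8)`.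
[cite: Chaiken1982, §2 (all minors matrix tree theorem)] [cite: Smith2016CongruentDensity, §2.2 case 5(b)]
[cite: HeathBrown1994SelmerCongruentII, Appendix (Monsky), typescript p. 39 L27–L41] -/
theorem adjugate_bigN_zero_root_inr_inr_add_eq_sum_admissible (a : V → V → ZMod 2) (y z : V → ZMod 2) {D : Finset V}
    (hrec : ∀ i ∈ D, ∀ j ∈ D, i ≠ j → a i j + a j i = y i * y j)
    {s t : V} (hs : s ∈ D) (ht : t ∈ D) (hst : s ≠ t) :
    (bigN a D y z 0).adjugate (Sum.inr s) (Sum.inr s) + (bigN a D y z 0).adjugate (Sum.inr t) (Sum.inr t) =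
      ∑ B ∈ D.powerset.filter (fun B => s ∈ B ∧ t ∈ B ∧ (∑ i ∈ B, y i = 0 ∧ ∑ i ∈ B, z i = 1)),
        (treeDet a B s + treeDet a B t) * (bigN a (D \ B) y z 0).det := by
  set D₀ := (D.erase s).erase t with hD₀
  have hsD₀ : s ∉ D₀ := fun h => notMem_erase s D (mem_of_mem_erase h)
  have htD₀ : t ∉ D₀ := notMem_erase t _
  have hD₀D : D₀ ⊆ D := (erase_subset t _).trans (erase_subset s D)
  rw [adjugate_bigN_zero_root_inr_inr_split a y z hs ht hst, adjugate_bigN_zero_root_inr_inr_split a y z ht hs hst.symm,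
    erase_right_comm (a := t) (b := s), ← hD₀, sum_admissible_pair_eq_sum_pinned a y z hrec hs ht hst, ← hD₀]
  -- the blocks containing both `s` and `t` cancel between the two cofactors
  have hcancel : ∑ B₁ ∈ D₀.powerset, (∑ i ∈ insert s (insert t B₁), y i) * treeDet a (insert s (insert t B₁)) s *
        setExp (fwt a y z 0) (D₀ \ B₁) +
      ∑ B₁ ∈ D₀.powerset, (∑ i ∈ insert t (insert s B₁), y i) * treeDet a (insert t (insert s B₁)) t *
        setExp (fwt a y z 0) (D₀ \ B₁) = 0 := by
    rw [← sum_add_distrib]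
    refine sum_eq_zero fun B₁ hB₁ => ?_
    rw [mem_powerset] at hB₁
    rw [insert_comm t s]
    have hBD : insert s (insert t B₁) ⊆ D := insert_subset hs (insert_subset ht (hB₁.trans hD₀D))
    by_cases hyB : ∑ i ∈ insert s (insert t B₁), y i = 1
    · rw [treeDet_eq_treeDet_of_odd a y (hrec_mono hBD hrec) hyB (mem_insert_self s _)
          (mem_insert_of_mem (mem_insert_self t B₁))]
      exact CharTwo.add_self_eq_zero _
    · have h01 : ∀ u : ZMod 2, u ≠ 1 → u = 0 := by decide
      rw [h01 _ hyB]
      ring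
  rw [add_add_add_comm, hcancel, zero_add, ← sum_add_distrib]
  refine sum_congr rfl fun W₀ hW₀ => ?_
  rw [mem_powerset] at hW₀
  have hsW₀ : s ∉ W₀ := fun h => hsD₀ (hW₀ h)
  have htW₀ : t ∉ W₀ := fun h => htD₀ (hW₀ h)
  rw [← mul_add]
  congr 1
  -- re-index the second inner sum by complementation inside `W₀`, then compare termwise
  rw [sum_powerset_eq_sum_powerset_sdiff W₀ (fun Y₀ =>
      (∑ i ∈ insert t Y₀, y i) * treeDet a (insert t Y₀) t * fwt a y z 0 (insert s (W₀ \ Y₀))), ← sum_add_distrib]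
  refine sum_congr rfl fun X₀ hX₀ => ?_
  rw [mem_powerset] at hX₀
  rw [Finset.sdiff_sdiff_eq_self hX₀]
  have hXD : insert s X₀ ⊆ D := insert_subset hs (hX₀.trans (hW₀.trans hD₀D))
  have hYD : insert t (W₀ \ X₀) ⊆ D := insert_subset ht (sdiff_subset.trans (hW₀.trans hD₀D))
  have hsum : ∀ f : V → ZMod 2, ∑ i ∈ insert s (insert t W₀), f i = ∑ i ∈ insert s X₀, f i + ∑ i ∈ insert t (W₀ \ X₀), f i := by
    intro f
    rw [← insert_union_insert_sdiff hX₀ s t, sum_union (disjoint_insert_insert_sdiff hX₀ hsW₀ htW₀ hst)]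
  have hterm := pair_term_identity a y z (mem_insert_self s X₀) (mem_insert_self t (W₀ \ X₀)) (hrec_mono hXD hrec)
    (hrec_mono hYD hrec)
  rw [hsum y, hsum z]
  have hY : setExp (qwt a y) (insert t (W₀ \ X₀)) = (∑ i ∈ insert t (W₀ \ X₀), y i) * qwt a y (insert t (W₀ \ X₀)) :=
    setExp_qwt_eq_sum_mul_qwt a y (insert_nonempty t _) (hrec_mono hYD hrec)
  rw [hY, ← hterm]

end Summit.BirchSwinnertonDyer.PrintCf2.QFormForest
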